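import Summits.QuantumFields.BalabanUV.Beta.CombHId2W2Slot
import Summits.QuantumFields.BalabanUV.Beta.CombHId2Words

/-!
# `BalabanUV.Beta.CombHId2W2Words` — binder row D1 (OWNER an2), (J-a) dictionary, (C2) at ORDER 2, part TWO-c (words): **THE OPERATOR's SECOND RESPONSE TABLE
# `W2OfK` UNDER THE DOOR's COPY SUM AND PERIODISATION** — word by word: `dM (K2_{b′}) S M b` (§1), `mixOfK M₂ b b′` ∕ `mixOfK M₂ b′ b` (§2), `vertex2OfK S₂ b b′` (§3)

WHY.  `WcombOf j = W2SymOfK (GcombSh j) Lc (SpureCombOf j) (tabs.M j) (T2_j) (M2Of mixFF j)` feeds `K3OfK`'s `W` slot; `CombHId2Periodised` delivers it on the torus as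
`W^{per,cs} b b′ := dper M (x z ↦ Σ'_n W b (b′+M′∘n) x z)`.  To READ that object through the door's jets (`H₂`, `Q₁₂`, and the response terms in `Γ̂`) one needs
`W2OfK` itself pushed through «copy-sum, then periodise»: `W2OfK K N S M S₂ M₂ b b′ = vertex2OfK K N S₂ b b′ + mixOfK K N M₂ b b′ + mixOfK K N M₂ b′ b + dM (K2OfK K N S M b′) N S M b`.
WHAT ([folklore]; 0 `def`, 0 cited fact, 0 `def … : Prop`, 0 sorry): §1 **`tsum_word₄`** (`Σ'_n dM (K2_{b′+M′∘n}) S M b = dM (dper M K2_{b′}) S M b` — C3c `K2OfK_translate_per` +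
`CombHId2W2Letters.tsum_dM_shiftK`), **`dper_tsum_word₄`** (`dper M` of it `= dM (K2OfK K N S^per M^per b′) N S^per M^per b` — `CombHId2W2Exchange.dper_dM'` + C3a `dper_K2OfK`).
§2 `abs_M₂_copy_le`, **`tsum_word₂`** (`Σ'_n mixOfK K N M₂ b (b′+M′∘n) = mixOfK K N M₂^{cs} b b′`), `biLoc_M₂_cs`, **`dper_tsum_word₂`** (`= mixOfK K N M₂^{per,cs} b b′`).
(Word 3 — the moving bond OUTSIDE — and word 1 follow in `CombHId2W2Mixed` ∕ `CombHId2W2Vertex2`.)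
NOT HERE: `W2SymOfK` assembled, the door's `hId₂`; nothing of Bałaban's asserted; NOT D1, NEVER «G-an2-4 closed», NOT BetaPertH, NOT continuum, NOT Clay.

HONEST DEPENDENCY (page 1, mandatory): continuum YM on T⁴ ⇐ BetaPertH ∧ nine spine estimates (0/9 proved); BetaPertH ⇐ (D1) ∧ (D4) ∧ CAP+tail;
G-an2-4 gates asym, D1 and NE2/3/4.  HONEST FRAMING (cell contract, verbatim): «discharging `BetaPertH` makes Bałaban's UV stability UNCONDITIONAL —
a real constructive-QFT result; it is NOT the continuum limit and NOT the Clay problem.»  ABSOLUTE RULE (cell charter, verbatim): «No internally-minted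
statement may enter as a cited fact. Every hypothesis is either kernel-proved in this package or a verbatim quotation of a PUBLISHED theorem with page
reference. The manuscript(s) under audit are NOT citable for their own disputed steps — they are the thing under adjudication; programme-internal
(2001/route/tribunal) claims are never citable.»  Row D1 OWNER an2 (b2b-balaban-beta-an2) gen 44, 2026-08-23; over C3a∕C3c∕`CombHId2Words`∕`CombHId2W2Letters∕Exchange` BY NAME.
-/

noncomputable section

open scoped BigOperators

namespace Summit.QuantumFields.BalabanUV.Beta.CombHId2W2Words

open Literature.MathematicalPhysics.QuantumFieldTheory.Balaban1983to89
open Literature.MathematicalPhysics.QuantumFieldTheory.Balaban1983to89.Beta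
open B12Sec2to5 (l1 l1_nonneg)
open B4TorusKernel.MultiPeriod (translate translate_apply)
open ExpKernelCalculus (MKer Decays BiLoc VertexFamily comp shiftK l1_sub_symm)
open AffineAveraging (Site)
open OneStepResolventKernel (Fib)
open OneStepKernelFamily (vertexOfK)
open SecondOrderResponse (vertexOfM dM K2OfK)
open Summit.QuantumFields.BalabanUV.Beta.FP.KernelPeriodisationFibLoc (dper dper_apply dper_translate decays_dper_diag)
open Summit.QuantumFields.BalabanUV.Beta.CombHId2Letters (dper_K2OfK)
open Summit.QuantumFields.BalabanUV.Beta.CombHId2CopySum (K2OfK_translate_per)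
open Summit.QuantumFields.BalabanUV.Beta.CombHId2Words (exists_biLoc_dM_K2OfK)
open Summit.QuantumFields.BalabanUV.Beta.CombHId2W2Letters (tsum_dM_shiftK)
open Summit.QuantumFields.BalabanUV.Beta.CombHId2W2Exchange (dper_dM' vertexOfM_translate_per vertexOfK_translate_per dper_vertexOfK' dper_vertexOfM_of_biLocAt)
open Summit.QuantumFields.BalabanUV.Beta.CombHId2W2Slot (tsum_vertexOfK_slot tsum_vertexOfM_slot abs_vertexOfM_le_of_far abs_vertexOfK_le_of_far biLoc_vertexOfM_of_biLocAt biLoc_vertexOfK_of_biLocAt)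

variable {d : ℕ} (M : Fin (d + 1) → ℕ) [∀ μ, NeZero (M μ)] {N : ℕ} [NeZero N] {M' : Fin (d + 1) → ℕ} {K : MKer (d + 1) (Fib d)}
  {CK δK CS δS CM δM : ℝ} {S Mt : Fin (d + 1) → Site (d + 1) → MKer (d + 1) (Fib d)}

/-! ## §1 Word 4: the first-order tables through the derivative of the inverse at the moving bond -/

/-- [folklore] **`Σ'_n dM (K2OfK … (b′+M′∘n)) N S M b = dM (dper M (K2OfK … b′)) N S M b`** (pointwise): the copies of `K2_{b′}` are the fine-period shifts of ONE
bi-localised kernel (C3c `K2OfK_translate_per`), and the vertices through the shifts sum to the vertex through the periodisation (`tsum_dM_shiftK`). -/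
theorem tsum_word₄ (hM : ∀ i, M i = N * M' i)
    (hKinv : ∀ (m x z : Site (d + 1)) (a b : Fib d), K (translate M x m) (translate M z m) a b = K x z a b)
    (hK : Decays K CK δK) (hδK : 0 < δK)
    (hSt : ∀ (κ : Fin (d + 1)) (u m x z : Site (d + 1)) (a b : Fib d), S κ (translate M u m) (translate M x m) (translate M z m) a b = S κ u x z a b)
    (hS : ∀ κ u, BiLoc (S κ u) u u CS δS) (hδS : 0 < δS)
    (hMt : ∀ (ρ : Fin (d + 1)) (w m x z : Site (d + 1)) (a b : Fib d), Mt ρ (translate M' w m) (translate M x m) (translate M z m) a b = Mt ρ w x z a b)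
    (hMloc : VertexFamily Mt N CM δM) (hδM : 0 < δM) (μ : Fin (d + 1)) (y : Site (d + 1)) (ν : Fin (d + 1)) (y' : Site (d + 1))
    (x z : Site (d + 1)) (a c : Fib d) :
    ∑' n : Site (d + 1), dM (K2OfK K N S Mt ν (translate M' y' n)) N S Mt μ y x z a c = dM (dper M (K2OfK K N S Mt ν y')) N S Mt μ y x z a c := by
  obtain ⟨C₀, δ₀, hδ₀, -, hK2⟩ := exists_biLoc_dM_K2OfK hK hδK hS hδS hMloc hδM
  rw [← tsum_dM_shiftK M (hK2 ν y') hδ₀ hS hδS hMloc hδM μ y x z a c,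
    ← (Equiv.neg (Site (d + 1))).tsum_eq fun n => dM (shiftK (fun i => (M i : ℤ) * n i) (K2OfK K N S Mt ν y')) N S Mt μ y x z a c]
  refine tsum_congr fun n => ?_
  rw [K2OfK_translate_per M hM hKinv hSt hMt ν y' n]
  simp only [Equiv.neg_apply]

/-- [folklore] **WORD 4, PERIODISED**: `dper M (x z ↦ Σ'_n dM (K2OfK … (b′+M′∘n)) N S M b x z) = dM (K2OfK K N S^per M^per b′) N S^per M^per b`
(`CombHId2W2Exchange.dper_dM'` for the decaying, non-invariant kernel `dper M (K2_{b′})`, then C3a `dper_K2OfK`). -/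
theorem dper_tsum_word₄ (hM : ∀ i, M i = N * M' i)
    (hKinv : ∀ (m x z : Site (d + 1)) (a b : Fib d), K (translate M x m) (translate M z m) a b = K x z a b)
    (hK : Decays K CK δK) (hCK : 0 ≤ CK) (hδK : 0 < δK)
    (hSt : ∀ (κ : Fin (d + 1)) (u m x z : Site (d + 1)) (a b : Fib d), S κ (translate M u m) (translate M x m) (translate M z m) a b = S κ u x z a b)
    (hS : ∀ κ u, BiLoc (S κ u) u u CS δS) (hδS : 0 < δS)
    (hMt : ∀ (ρ : Fin (d + 1)) (w m x z : Site (d + 1)) (a b : Fib d), Mt ρ (translate M' w m) (translate M x m) (translate M z m) a b = Mt ρ w x z a b)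
    (hMloc : VertexFamily Mt N CM δM) (hδM : 0 < δM) (μ : Fin (d + 1)) (y : Site (d + 1)) (ν : Fin (d + 1)) (y' : Site (d + 1)) :
    dper M (fun x z a c => ∑' n : Site (d + 1), dM (K2OfK K N S Mt ν (translate M' y' n)) N S Mt μ y x z a c)
      = dM (K2OfK K N (fun κ u => dper M (S κ u)) (fun ρ w => dper M (Mt ρ w)) ν y') N (fun κ u => dper M (S κ u)) (fun ρ w => dper M (Mt ρ w)) μ y := by
  obtain ⟨C₀, δ₀, hδ₀, -, hK2⟩ := exists_biLoc_dM_K2OfK hK hδK hS hδS hMloc hδM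
  have hC₀ : 0 ≤ C₀ := (hK2 0 0).nonneg (Sum.inl 0)
  have h1 : (fun x z a c => ∑' n : Site (d + 1), dM (K2OfK K N S Mt ν (translate M' y' n)) N S Mt μ y x z a c)
      = dM (dper M (K2OfK K N S Mt ν y')) N S Mt μ y := by
    funext x z a c
    exact tsum_word₄ M hM hKinv hK hδK hSt hS hδS hMt hMloc hδM μ y ν y' x z a c
  rw [h1, dper_dM' M (decays_dper_diag M (hK2 ν y') hC₀ hδ₀) (half_pos hδ₀) hS hδS hMloc hδM μ y,
    dper_K2OfK M K S Mt hM hKinv hK hCK hδK hSt hS hδS hMt hMloc hδM ν y']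

/-! ## §2 Word 2: the mixed table with the moving bond INSIDE (`mixOfK K N M₂ b (b′+M′∘n)`) -/

section Word2

variable {M₂ : Fin (d + 1) → Site (d + 1) → Fin (d + 1) → Site (d + 1) → MKer (d + 1) (Fib d)} {Cm δm : ℝ}

omit [∀ μ, NeZero (M μ)] [NeZero N] in
/-- [folklore] the `n`-th copy of the mixed table's coarse index, as a coarse family, is localised away from the column at `u − M∘n`:
`|M₂ κ u ρ (w + M′∘n) x z a c| ≤ Cm·e^{−δm|u + M∘(−n) − N•w|₁}` (`LocStencilFM`, `M = N·M′`). -/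
theorem abs_M₂_copy_le (hM : ∀ i, M i = N * M' i) (hM₂ : SecondOrderResponse.LocStencilFM N M₂ Cm δm) (hδm : 0 ≤ δm)
    (κ : Fin (d + 1)) (u : Site (d + 1)) (n : Site (d + 1)) (ρ : Fin (d + 1)) (w x z : Site (d + 1)) (a c : Fib d) :
    |M₂ κ u ρ (translate M' w n) x z a c| ≤ Cm * Real.exp (-δm * l1 (translate M u (-n) - (N : ℤ) • w)) := by
  have hCm : 0 ≤ Cm := hM₂.nonneg
  refine (hM₂ κ u ρ (translate M' w n) x z a c).trans ?_
  have e : u - (N : ℤ) • translate M' w n = translate M u (-n) - (N : ℤ) • w := by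
    rw [CombHId1Letters.nsmul_translate hM]
    funext i; simp only [Pi.sub_apply, translate_apply, Pi.smul_apply, smul_eq_mul, Pi.neg_apply, mul_neg]; ring
  rw [e]
  have h1 : Real.exp (-δm * (l1 (x - u) + l1 (z - u))) ≤ 1 := by
    rw [Real.exp_le_one_iff]; exact mul_nonpos_of_nonpos_of_nonneg (neg_nonpos.2 hδm) (add_nonneg (l1_nonneg _) (l1_nonneg _))
  calc Cm * Real.exp (-δm * l1 (translate M u (-n) - (N : ℤ) • w)) * Real.exp (-δm * (l1 (x - u) + l1 (z - u)))
      ≤ Cm * Real.exp (-δm * l1 (translate M u (-n) - (N : ℤ) • w)) * 1 := mul_le_mul_of_nonneg_left h1 (by positivity)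
    _ = _ := mul_one _

/-- [folklore] **`Σ'_n mixOfK K N M₂ b (b′+M′∘n) = mixOfK K N M₂^{cs} b b′`** (pointwise), `M₂^{cs} κ u ρ w := x z a c ↦ Σ'_n M₂ κ u ρ (w + M′∘n) x z a c`:
the moving bond sits in the INNER multiplier-column vertex (`vertexOfM_translate_per`), whose copies sum inside the OUTER field-column vertex's slot
(`tsum_vertexOfK_slot`, majorant from `abs_vertexOfM_le_of_far`) and then inside the inner vertex's slot (`tsum_vertexOfM_slot`). -/
theorem tsum_word₂ (hM : ∀ i, M i = N * M' i)
    (hKinv : ∀ (m x z : Site (d + 1)) (a b : Fib d), K (translate M x m) (translate M z m) a b = K x z a b)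
    (hK : Decays K CK δK) (hδK : 0 < δK) (hM₂ : SecondOrderResponse.LocStencilFM N M₂ Cm δm) (hδm : 0 < δm)
    (μ : Fin (d + 1)) (y : Site (d + 1)) (ν : Fin (d + 1)) (y' : Site (d + 1)) (x z : Site (d + 1)) (a c : Fib d) :
    ∑' n : Site (d + 1), SecondOrderResponse.mixOfK K N M₂ μ y ν (translate M' y' n) x z a c
      = SecondOrderResponse.mixOfK K N (fun κ u ρ w => fun x z a c => ∑' n : Site (d + 1), M₂ κ u ρ (translate M' w n) x z a c) μ y ν y' x z a c := by
  have hCK : 0 ≤ CK := hK.nonneg (Sum.inl 0)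
  have hCm : 0 ≤ Cm := hM₂.nonneg
  have hN : 1 ≤ N := Nat.one_le_iff_ne_zero.mpr (NeZero.ne N)
  set r : ℝ := min δK δm with hr
  have hr0 : 0 < r := lt_min hδK hδm
  -- the outer family and its far bound in `n`
  set F : Site (d + 1) → Fin (d + 1) → Site (d + 1) → MKer (d + 1) (Fib d) :=
    fun n κ u => vertexOfM K N (fun ρ w => M₂ κ u ρ (translate M' w n)) ν y' with hF
  set Z : ℝ := ∑' w : Site (d + 1), Real.exp (-(r / 2) * l1 ((N : ℤ) • w - (N : ℤ) • y')) with hZ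
  have hZ0 : 0 ≤ Z := tsum_nonneg fun w => (Real.exp_pos _).le
  have hFb : ∀ n κ u x z a c, |F n κ u x z a c| ≤ ((d + 1 : ℕ) * (CK * Cm * Z)) * Real.exp (-(r / 2) * l1 (translate M ((N : ℤ) • y') n - u)) := by
    intro n κ u x z a c
    have h := abs_vertexOfM_le_of_far (N := N) hK hδK (G := fun ρ w => M₂ κ u ρ (translate M' w n)) (q := translate M u (-n))
      (fun ρ w x z a c => abs_M₂_copy_le M hM hM₂ hδm.le κ u n ρ w x z a c) hCm hδm ν y' x z a c
    have e : l1 (translate M u (-n) - (N : ℤ) • y') = l1 (translate M ((N : ℤ) • y') n - u) := by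
      rw [l1_sub_symm]; congr 1; funext i; simp only [Pi.sub_apply, translate_apply, Pi.neg_apply, mul_neg]; ring
    rw [e] at h
    exact h
  -- step 1: move the bond inside, pointwise
  have h1 : ∀ n, SecondOrderResponse.mixOfK K N M₂ μ y ν (translate M' y' n) = vertexOfK K N (F n) μ y := by
    intro n
    show vertexOfK K N (fun κ u => vertexOfM K N (M₂ κ u) ν (translate M' y' n)) μ y = _
    congr 1
    funext κ u
    exact vertexOfM_translate_per M hM hKinv (M₂ κ u) ν y' n
  simp only [h1]
  -- step 2: the outer slot
  rw [tsum_vertexOfK_slot M hK hδK hFb (by positivity) (half_pos hr0) μ y x z a c]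
  -- step 3: the inner slot, for every `κ u`
  show vertexOfK K N (fun κ u => fun x z a c => ∑' n : Site (d + 1), F n κ u x z a c) μ y x z a c = _
  congr 1
  funext κ u x' z' a' c'
  rw [hF]
  dsimp only
  rw [← (Equiv.neg (Site (d + 1))).tsum_eq fun n => vertexOfM K N (fun ρ w => M₂ κ u ρ (translate M' w n)) ν y' x' z' a' c']
  have hG : ∀ n ρ w x z a c, |M₂ κ u ρ (translate M' w ((Equiv.neg (Site (d + 1))) n)) x z a c| ≤ Cm * Real.exp (-δm * l1 (translate M u n - (N : ℤ) • w)) := by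
    intro n ρ w x z a c
    have h := abs_M₂_copy_le M hM hM₂ hδm.le κ u (-n) ρ w x z a c
    rw [neg_neg] at h
    exact h
  rw [tsum_vertexOfM_slot M hK hδK hG hCm hδm ν y' x' z' a' c']
  congr 1
  funext ρ w x'' z'' a'' c''
  exact (Equiv.neg (Site (d + 1))).tsum_eq fun n => M₂ κ u ρ (translate M' w n) x'' z'' a'' c''

omit [NeZero N] in
/-- [folklore] the copy-summed mixed table `M₂^{cs} κ u ρ w` is localised at its fine bond `u`, UNIFORMLY in the coarse index (constant `Cm·K_{d+1}(δm)`). -/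
theorem biLoc_M₂_cs (hM : ∀ i, M i = N * M' i) (hM₂ : SecondOrderResponse.LocStencilFM N M₂ Cm δm) (hδm : 0 < δm)
    (κ : Fin (d + 1)) (u : Site (d + 1)) (ρ : Fin (d + 1)) (w : Site (d + 1)) :
    BiLoc (fun x z a c => ∑' n : Site (d + 1), M₂ κ u ρ (translate M' w n) x z a c) u u (Cm * B4Sect5Proof.latticeConst (d + 1) δm) δm := by
  have hCm : 0 ≤ Cm := hM₂.nonneg
  have hT : ∀ n x z a c, |M₂ κ u ρ (translate M' w n) x z a c|
      ≤ (Cm * Real.exp (-δm * l1 (translate M ((N : ℤ) • w) n - u))) * Real.exp (-δm * (l1 (x - u) + l1 (z - u))) := by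
    intro n x z a c
    have h := hM₂ κ u ρ (translate M' w n) x z a c
    rwa [CombHId1Letters.nsmul_translate hM, l1_sub_symm] at h
  obtain ⟨hs, hle⟩ := FP.KernelPeriodisationFibLoc.summable_exp_l1_translate M hδm u ((N : ℤ) • w)
  have h := CombHId2CopySum.biLoc_tsum_family (T := fun n => M₂ κ u ρ (translate M' w n)) hT (hs.mul_left Cm)
  refine BalabanStepW2.biLoc_le_mono h (tsum_nonneg fun n => by positivity) ?_ le_rfl
  rw [tsum_mul_left]
  exact mul_le_mul_of_nonneg_left hle hCm

/-- [folklore] **WORD 2, PERIODISED**: `dper M (x z ↦ Σ'_n mixOfK K N M₂ b (b′+M′∘n) x z) = mixOfK K N M₂^{per,cs} b b′`,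
`M₂^{per,cs} κ u ρ w := dper M (x z ↦ Σ'_n M₂ κ u ρ (w + M′∘n) x z)` — the mixed table's coarse index copy-summed, then periodised (`dper_vertexOfK'` on the outer vertex,
`dper_vertexOfM_of_biLocAt` on the inner one, whose family is localised at the common fine bond `u`). -/
theorem dper_tsum_word₂ (hM : ∀ i, M i = N * M' i)
    (hKinv : ∀ (m x z : Site (d + 1)) (a b : Fib d), K (translate M x m) (translate M z m) a b = K x z a b)
    (hK : Decays K CK δK) (hδK : 0 < δK) (hM₂ : SecondOrderResponse.LocStencilFM N M₂ Cm δm) (hδm : 0 < δm)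
    (μ : Fin (d + 1)) (y : Site (d + 1)) (ν : Fin (d + 1)) (y' : Site (d + 1)) :
    dper M (fun x z a c => ∑' n : Site (d + 1), SecondOrderResponse.mixOfK K N M₂ μ y ν (translate M' y' n) x z a c)
      = SecondOrderResponse.mixOfK K N (fun κ u ρ w => dper M (fun x z a c => ∑' n : Site (d + 1), M₂ κ u ρ (translate M' w n) x z a c)) μ y ν y' := by
  have hcs := fun κ u => biLoc_M₂_cs M hM hM₂ hδm κ u
  -- the inner vertices over the copy-summed table are localised at their fine bond
  have hT : ∀ κ u, BiLoc (vertexOfM K N (fun ρ w => fun x z a c => ∑' n : Site (d + 1), M₂ κ u ρ (translate M' w n) x z a c) ν y') u u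
      ((d + 1 : ℕ) * (CK * ∑' w : Site (d + 1), Real.exp (-δK * l1 ((N : ℤ) • w - (N : ℤ) • y'))) * (Cm * B4Sect5Proof.latticeConst (d + 1) δm)) δm :=
    fun κ u => biLoc_vertexOfM_of_biLocAt (N := N) hK hδK (hcs κ u) ν y'
  have h1 : (fun x z a c => ∑' n : Site (d + 1), SecondOrderResponse.mixOfK K N M₂ μ y ν (translate M' y' n) x z a c)
      = vertexOfK K N (fun κ u => vertexOfM K N (fun ρ w => fun x z a c => ∑' n : Site (d + 1), M₂ κ u ρ (translate M' w n) x z a c) ν y') μ y := by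
    funext x z a c
    exact tsum_word₂ M hM hKinv hK hδK hM₂ hδm μ y ν y' x z a c
  rw [h1, dper_vertexOfK' M hK hδK hT hδm μ y]
  show _ = vertexOfK K N (fun κ u => vertexOfM K N (fun ρ w => dper M (fun x z a c => ∑' n : Site (d + 1), M₂ κ u ρ (translate M' w n) x z a c)) ν y') μ y
  congr 1
  funext κ u
  exact dper_vertexOfM_of_biLocAt M (N := N) hK hδK (hcs κ u) hδm ν y'

end Word2

end Summit.QuantumFields.BalabanUV.Beta.CombHId2W2Words

end
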